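import Mathlib
import HarnessLib
import Literature.MathematicalPhysics.QuantumLattice.HubbardCounterQuadraticResummation
import Literature.MathematicalPhysics.QuantumLattice.HubbardUVSymbolCTDifferences
import Summits.HubbardSuperconductivity.HubbardSuperconductivity.Theorems.KLProgrammeSectorisedLegKernelsDefs
import Summits.HubbardSuperconductivity.HubbardSuperconductivity.Theorems.KLProgrammeKLRegimeTwoPointAssemblyRepr

/-!
# K3 ENGINE (stmt-HubbardSuperconductivity-20236 `KLRegimeEngineV16`), two-leg lane, repair (ρ2)(ii) of the GLOBAL-MOMENTUM-SIZES
# finding: the K-RESUMMED representation of the scale-`n` self-energy — the counterterm chain is explicit, and ON THE TUBE it is absent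

Cell gate-hubbard-kl, seat hubbard-kl-k3c5-p1 g7.  `klSelfEnergy … n = selfEnergy (effAction C^K_{>Λ_n} (V_U + 𝒩_K))` reads the
K-VERTEX representation, whose two-leg kernel contains the chain of the counterterm vertex through the UV covariance
(`K + K²·Φ̃ + …`, Hartree-dressed), supported OFF the reading tube and responsible for the unfeedable global momentum sizes (evidence
GLOBAL-MOMENTUM-SIZES-FINDING.md on 20236).  Since `C^K_{>Λ}` at seed `0` is a NORMAL covariance (`hubbardCovAboveCT_zero_seed`) and
`𝒩_K` is diagonal in `(k,σ)`, the Literature identity `selfEnergy_effAction_add_counterQuadratic` applies verbatim: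

* **`klSelfEnergy_eq_chain_add_resummed`** — for `β ≠ 0`, every frame with `1 + Ψ_Λ(k,σ)·K(p_k⃗)/(βL²) ≠ 0` (automatic for `‖K‖_∞ < Λ/2`)
  and unit partition function: `Σ_n(k,σ) = K(p_k⃗) − K(p_k⃗)²·Ψ̃(k,σ)/(βL²) + (1 − K(p_k⃗)·Ψ̃(k,σ)/(βL²))²·Σ^{res}_n(k,σ)`, where
  `Ψ = uvSymbolCT … K Λ_n` is the symbol of `C^K_{>Λ_n}`, `Ψ̃ = Ψ/(1 + Ψ·K/(βL²))` the RESUMMED symbol, and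
  `Σ^{res}_n = selfEnergy (effAction (normalCovariance Ψ̃) V_U)` — the self-energy of the PURELY QUARTIC theory with the resummed
  covariance (NO counterterm vertex);
* **`klSelfEnergy_eq_frame_add_resummed_of_weight_eq_zero`**, **`…_of_sq_add_sq_le`** — on the zero set of the cutoff weight
  (`ω² + e_K(k)² ≤ Λ_n²/4`, which contains the reading curve `e_K = 0` at `±ω₀` as soon as `ω₀ ≤ Λ_n/2`):
  `Σ_n(k,σ) = K(p_k⃗) + Σ^{res}_n(k,σ)` EXACTLY — so every ON-TUBE size of `Σ_n − K∘p` is a size of `Σ^{res}_n`, a function with no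
  chain anywhere.

Proofs only; no definitions (the resummed symbol is written out); nothing about the model's sizes is asserted here.
-/

noncomputable section

namespace Summit.HubbardSuperconductivity.HubbardSuperconductivity.Theorems.KLRegimeSplit

set_option linter.dupNamespace false -- summit = problem name (single-conjunct summit), D-0017

open Literature.MathematicalPhysics.QuantumLattice Literature.Probability.LatticeModels GrassmannAlgebra
open Summit.HubbardSuperconductivity.HubbardSuperconductivity.Theorems.KLProgrammeLegKernels
open Summit.HubbardSuperconductivity.HubbardSuperconductivity.Theorems.TwoPointAssembly

variable {L M : ℕ} [NeZero L]

/-- `V_U` is even and has no constant part; the scale-`n` action in the Literature shape. -/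
theorem klEffectiveAction_eq_effAction_normalCovariance (β U μ : ℝ) (K : TrigPolyC4v) (e₀ : ℝ) (n : ℕ) :
    klEffectiveAction L M β U μ K e₀ n =
      effAction ℂ (normalCovariance L M (uvSymbolCT L M β μ K (klScale e₀ n)))
        (hubbardInteraction L M β U + counterQuadratic L M β K) := by
  rw [klEffectiveAction, hubbardEffectiveActionCT_def, hubbardCovAboveCT_zero_seed_eq_normalCovariance_uvSymbolCT]
  rfl

/-- **The K-resummed representation of the scale-`n` self-energy.**  With `Ψ = uvSymbolCT … K Λ_n`, `κ_k = K(p_k⃗)/(βL²)`,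
`Ψ̃ = Ψ/(1 + Ψκ)`: `Σ_n(k,σ) = K(p_k⃗) − βL²·κ_k²·Ψ̃(k,σ) + (1 − κ_k·Ψ̃(k,σ))²·selfEnergy (effAction (normalCovariance Ψ̃) V_U) (k,σ)`. -/
theorem klSelfEnergy_eq_chain_add_resummed {β : ℝ} (hβ : β ≠ 0) (U μ : ℝ) (K : TrigPolyC4v) (e₀ : ℝ) (n : ℕ)
    (hden : ∀ ks : FreqMomentum L M × Fin 2,
      1 + uvSymbolCT L M β μ K (klScale e₀ n) ks * ((K.eval (latticeMomentum L ks.1.2) / (β * (L : ℝ) ^ 2) : ℝ) : ℂ) ≠ 0)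
    (hZ : IsUnit (hubbardEffPartitionFnCT L M β U μ 0 K (klScale e₀ n))) (k : FreqMomentum L M) (σ : Fin 2) :
    klSelfEnergy L M β U μ K e₀ n k σ =
      (K.eval (latticeMomentum L k.2) : ℂ) -
        ((β * (L : ℝ) ^ 2 : ℝ) : ℂ) * ((K.eval (latticeMomentum L k.2) / (β * (L : ℝ) ^ 2) : ℝ) : ℂ) ^ 2 *
          (uvSymbolCT L M β μ K (klScale e₀ n) (k, σ) /
            (1 + uvSymbolCT L M β μ K (klScale e₀ n) (k, σ) * ((K.eval (latticeMomentum L k.2) / (β * (L : ℝ) ^ 2) : ℝ) : ℂ))) +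
        (1 - ((K.eval (latticeMomentum L k.2) / (β * (L : ℝ) ^ 2) : ℝ) : ℂ) *
            (uvSymbolCT L M β μ K (klScale e₀ n) (k, σ) /
              (1 + uvSymbolCT L M β μ K (klScale e₀ n) (k, σ) * ((K.eval (latticeMomentum L k.2) / (β * (L : ℝ) ^ 2) : ℝ) : ℂ)))) ^ 2 *
          selfEnergy L M β (effAction ℂ (normalCovariance L M fun ks =>
            uvSymbolCT L M β μ K (klScale e₀ n) ks /
              (1 + uvSymbolCT L M β μ K (klScale e₀ n) ks * ((K.eval (latticeMomentum L ks.1.2) / (β * (L : ℝ) ^ 2) : ℝ) : ℂ)))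
            (hubbardInteraction L M β U)) k σ := by
  have hV : hubbardInteraction L M β U ∈ evenPart ℂ (HubbardFieldIdx L M) :=
    (mem_evenPart_iff).2 (hubbardInteraction_mem_evenOdd_zero L M β U)
  have hV0 : constPart ℂ (hubbardInteraction L M β U) = 0 := constPart_hubbardInteraction L M β U
  have hZ' : IsUnit (effPartitionFn ℂ (normalCovariance L M (uvSymbolCT L M β μ K (klScale e₀ n)))
      (hubbardInteraction L M β U + counterQuadratic L M β K)) := by
    have h : hubbardEffPartitionFnCT L M β U μ 0 K (klScale e₀ n) =
        effPartitionFn ℂ (normalCovariance L M (uvSymbolCT L M β μ K (klScale e₀ n)))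
          (hubbardInteraction L M β U + counterQuadratic L M β K) := by
      rw [hubbardEffPartitionFnCT, hubbardCovAboveCT_zero_seed_eq_normalCovariance_uvSymbolCT]
      rfl
    rwa [h] at hZ
  rw [klSelfEnergy, klEffectiveAction_eq_effAction_normalCovariance,
    selfEnergy_effAction_add_counterQuadratic _ hV hV0 β K hden hZ' k σ]
  have hkey : ((β * (L : ℝ) ^ 2 : ℝ) : ℂ) * ((K.eval (latticeMomentum L k.2) / (β * (L : ℝ) ^ 2) : ℝ) : ℂ) =
      (K.eval (latticeMomentum L k.2) : ℂ) := by
    have hL' : (L : ℂ) ≠ 0 := by exact_mod_cast NeZero.ne L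
    have hβ' : (β : ℂ) ≠ 0 := by exact_mod_cast hβ
    push_cast
    field_simp
  rw [hkey]

/-- **On the zero set of the cutoff weight the chain is absent**: if `w^K_{Λ_n}(k) = 0` then
`Σ_n(k,σ) = K(p_k⃗) + selfEnergy (effAction (normalCovariance Ψ̃) V_U) (k,σ)`. -/
theorem klSelfEnergy_eq_frame_add_resummed_of_weight_eq_zero {β : ℝ} (hβ : β ≠ 0) (U μ : ℝ) (K : TrigPolyC4v) (e₀ : ℝ)
    (n : ℕ)
    (hden : ∀ ks : FreqMomentum L M × Fin 2,
      1 + uvSymbolCT L M β μ K (klScale e₀ n) ks * ((K.eval (latticeMomentum L ks.1.2) / (β * (L : ℝ) ^ 2) : ℝ) : ℂ) ≠ 0)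
    (hZ : IsUnit (hubbardEffPartitionFnCT L M β U μ 0 K (klScale e₀ n))) (k : FreqMomentum L M) (σ : Fin 2)
    (hk : hubbardCutoffWeightCT L M β μ K (klScale e₀ n) k = 0) :
    klSelfEnergy L M β U μ K e₀ n k σ =
      (K.eval (latticeMomentum L k.2) : ℂ) +
        selfEnergy L M β (effAction ℂ (normalCovariance L M fun ks =>
          uvSymbolCT L M β μ K (klScale e₀ n) ks /
            (1 + uvSymbolCT L M β μ K (klScale e₀ n) ks * ((K.eval (latticeMomentum L ks.1.2) / (β * (L : ℝ) ^ 2) : ℝ) : ℂ)))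
          (hubbardInteraction L M β U)) k σ := by
  have hΨ : uvSymbolCT L M β μ K (klScale e₀ n) (k, σ) = 0 := by
    rw [uvSymbolCT, hk]
    push_cast
    ring
  rw [klSelfEnergy_eq_chain_add_resummed hβ U μ K e₀ n hden hZ k σ, hΨ]
  ring

/-- **The same on the geometric tube** `ω² + e_K(k)² ≤ Λ_n²/4` (there `χ₂((ω²+e²)/Λ²) = 0`; the reading curve `e_K = 0` at `±ω₀` lies in
it as soon as `ω₀ ≤ Λ_n/2`). -/
theorem klSelfEnergy_eq_frame_add_resummed_of_sq_add_sq_le {β : ℝ} (hβ : β ≠ 0) (U μ : ℝ) (K : TrigPolyC4v) {e₀ : ℝ} (he₀ : 0 < e₀)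
    (n : ℕ)
    (hden : ∀ ks : FreqMomentum L M × Fin 2,
      1 + uvSymbolCT L M β μ K (klScale e₀ n) ks * ((K.eval (latticeMomentum L ks.1.2) / (β * (L : ℝ) ^ 2) : ℝ) : ℂ) ≠ 0)
    (hZ : IsUnit (hubbardEffPartitionFnCT L M β U μ 0 K (klScale e₀ n))) (k : FreqMomentum L M) (σ : Fin 2)
    (hk : matsubaraFreq β M k.1 ^ 2 + nambuXiCT L μ K k.2 ^ 2 ≤ klScale e₀ n ^ 2 / 4) :
    klSelfEnergy L M β U μ K e₀ n k σ =
      (K.eval (latticeMomentum L k.2) : ℂ) +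
        selfEnergy L M β (effAction ℂ (normalCovariance L M fun ks =>
          uvSymbolCT L M β μ K (klScale e₀ n) ks /
            (1 + uvSymbolCT L M β μ K (klScale e₀ n) ks * ((K.eval (latticeMomentum L ks.1.2) / (β * (L : ℝ) ^ 2) : ℝ) : ℂ)))
          (hubbardInteraction L M β U)) k σ := by
  have hΛ : 0 < klScale e₀ n := by unfold klScale; positivity
  refine klSelfEnergy_eq_frame_add_resummed_of_weight_eq_zero hβ U μ K e₀ n hden hZ k σ ?_
  rw [hubbardCutoffWeightCT]
  refine salmhoferCutoff_of_le ?_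
  rw [div_le_iff₀ (by positivity)]
  linarith

end Summit.HubbardSuperconductivity.HubbardSuperconductivity.Theorems.KLRegimeSplit

end
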